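import Literature.NumberTheory.DiophantineGeometry.ValuationProductElliptic
import Literature.NumberTheory.DiophantineGeometry.PastenValuationProducts
import HarnessLib

/-!
# Products of valuations of the minimal discriminant — proofs

Proof file for `Literature/NumberTheory/DiophantineGeometry/ValuationProductElliptic.lean`
(named facts from H. Pasten, *Shimura curves and the abc conjecture*, J. Number Theory 254 (2024)
214–335 = arXiv:1705.09251, held and read: p. 8 (Thm 1.12), p. 49 (Cor 16.2), p. 50 (Thm 16.5 and
its proof) of the arXiv text).

## Contents

* `pastenShimura2024_thm_1_12_of_cor_16_2` — the PRINTED proof of Theorem 1.12 (= Theorem 16.5,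
  first part): "If `N_E = p` is prime then `v_p(Δ_E) ≤ 5` (cf. [MestreOesterle]). The first part
  of the result now follows from Corollary (CoroValGen) with `S = ∅`." (arXiv p. 50), i.e.
  `pastenShimura2024_cor_16_2 → mestreOesterle1989_thm_1 → pastenShimura2024_thm_1_12`, fully
  proved (elementary bookkeeping: squarefree conductors, the cases `ω(N_E) = 0, 1, ≥ 2`, and the
  constant `max K 6`).
* `pastenShimura2024_cor_16_2_of_thm_16_1_explicit`, `pastenShimura2024_cor_16_2_of_thm_16_1` —
  the PRINTED proof of Corollary 16.2 from Theorem 16.1 (arXiv p. 49), Theorem 16.1 being taken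
  as an explicit hypothesis in the shape "for every admissible factorisation `N_E = D·M` (`D` a
  nonempty product of an even number of primes, `gcd(D, M) = 1`), `∏_{p ∣ D} v_p(Δ_E) < K·N_E^{11/3+ε}`":
  with an even number of multiplicative primes take `D = N_E^*`; with an odd number `n ≥ 3` of them,
  `p_1, …, p_n`, use the factorisations `D = N_E^*/p_i` ("since `11/3 · n/(n-1) ≤ 11/2`"; here with
  three of them, each prime lying in two: `(∏ v_p)² ≤ ∏_{i ≤ 3} ∏_{p ∣ N_E^*/p_i} v_p`, `11/3 · 3/2 = 11/2`).
* `pastenShimura2024_cor_16_2.eventually` — the printed "all but finitely many `E`" shape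
  (`∃ N₀, N_E ≥ N₀ → ∏_{p ∣ N_E^*} v_p(Δ_E) < N_E^{11/2+ε}`) from the constant form (`ε/2` and
  `N₀ = ⌈K^{2/ε}⌉`).
* `pastenShimura2024_cor_16_2_iff_pasten_valuationProduct_awayFrom` — the fact of this topic's
  `ValuationProductElliptic` and `pasten_valuationProduct_awayFrom` of `PastenValuationProducts` are
  the same statement (`Iff.rfl`).
  (These four declarations were first landed by p41495 and inadvertently dropped by the whole-file
  resubmission p42427, which had been prepared from an older copy of this file; they are restored
  here with the same statements and new proofs.)

## Status of the discharge `pastenShimura2024_thm_1_12_holds`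

By the theorem below it is EXACTLY the conjunction of the discharges of the two inputs of the
printed proof, both existing named facts of the parent file and both far beyond the present
library: `pastenShimura2024_cor_16_2` (Pasten §4–§16.1: Shimura-curve parametrisations
`X_0^D(M) → E`, Jacquet–Langlands / refined Ribet–Takahashi, Arakelov lower bounds, modularity)
and `mestreOesterle1989_thm_1` (prime conductor, `Δ_min ∣ N_E^5`: `X_0(p)`, Mazur,
modularity).
Nothing is assumed here: the theorem takes them as explicit hypotheses, as
`mestreOesterle1989_thm_1.factorization_le` does in the parent file.

## Status of the discharge `mestreOesterle1989_thm_1_holds` (prime conductor, `Δ_min ∣ N_E^5`)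

The fact `mestreOesterle1989_thm_1` of the parent file is the case `N_E = p` of the printed
Théorème 1 of Mestre–Oesterlé (J. reine angew. Math. 400 (1989) 173–184; review Zbl 0693.14004 by
E.-U. Gekeler: "If `E` is [a semi-stable Weil curve] such that `|Δ|` is an `m`-th power, then
`m ≤ 5`, and `E` has an `m`-division point over `ℚ`"), vendored as the named fact
`Literature.NumberTheory.EllipticCurves.mestreOesterle1989_thm_1`; the reduction (prime conductor
⟹ semistable and `|Δ_min| = p^{v_p(Δ_min)}` a `v_p(Δ_min)`-th power) is PROVED in
`Literature/NumberTheory/EllipticCurves/PastenValuationProductMestreOesterleProofs.lean`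
(`Literature.NumberTheory.EllipticCurves.mestreOesterle1989_thm_1.dvd_pow_five :
 EllipticCurves.mestreOesterle1989_thm_1 → DiophantineGeometry.mestreOesterle1989_thm_1`, with
`WeierstrassCurve.isSemistable_iff_squarefree_conductorNorm`,
`WeierstrassCurve.minimalDiscriminantNorm_eq_pow_of_prime_conductorNorm`), so the discharge here is
the one-liner `mestreOesterle1989_thm_1.dvd_pow_five ‹…thm_1_holds›` once Théorème 1 is discharged.
Its published proof needs, for a prime `ℓ ∣ m`: `E[ℓ]` finite flat at `ℓ` and unramified at
`p ≠ ℓ` (Tate curve, `ℓ ∣ v_p(Δ)`); Ribet's level-lowering theorem [Invent. Math. 100 (1990)] with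
Serre's argument [Duke Math. J. 54 (1987)] to exclude irreducible `E[ℓ]`, `ℓ ≥ 11` (no weight-`2`
cusp forms of level `1`); Mazur's theorems in the reducible case; a case analysis excluding
`7, 10, 15, 6, 9, 25, 8 ∣ m`; and the modularity of `E/ℚ` (Wiles, Taylor–Wiles; BCDT —
`Literature.NumberTheory.EllipticCurves.ModularForms.exists_isNewformOf`) to remove "Weil". None
of these is proved in the tree or Mathlib. (A duplicate DG-side copy of the reduction, landed by
p42427, was withdrawn in favour of the `EllipticCurves` one.)

## References

* [PastenShimura2024] H. Pasten, *Shimura curves and the abc conjecture*, J. Number Theory 254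
  (2024) 214–335, doi:10.1016/j.jnt.2023.07.002, arXiv:1705.09251 — §16.3, proof of Thm 16.5.
* [MestreOesterle1989] J.-F. Mestre, J. Oesterlé, *Courbes de Weil semi-stables de discriminant une
  puissance m-ième*, J. reine angew. Math. 400 (1989) 173–184, Théorème 1.
-/

noncomputable section

namespace Literature.NumberTheory.DiophantineGeometry

/-- **Pasten, proof of Theorem 16.5, first part** (arXiv:1705.09251, §16.3, p. 50): Theorem 1.12
(`pastenShimura2024_thm_1_12`) follows from Corollary 16.2 with `S = ∅` and Mestre–Oesterlé.
Printed proof, verbatim: "If `N_E = p` is prime then `v_p(Δ_E) ≤ 5` (cf. [MestreOesterle]). The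
first part of the result now follows from Corollary (CoroValGen) [= Corollary 16.2] with
`S = ∅`."
Formalised exactly along these lines, with the constant `K'_ε = max (K_{∅,ε}) 6`:
* `ω(N_E) ≥ 2`: a squarefree conductor has no prime `p` with `p² ∣ N_E`, every prime factor is a
  multiplicative prime, and `pastenShimura2024_cor_16_2` (with `S = ∅`) bounds
  `multiplicativeValuationProduct W = ∏_{p ∣ N_E} v_p(Δ_E)`
  (`multiplicativeValuationProduct_eq_of_squarefree`);
* `ω(N_E) = 1`: `N_E` squarefree with one prime factor is a prime `p`, and
  `mestreOesterle1989_thm_1.factorization_le` gives `v_p(Δ_E) ≤ 5 < 6 ≤ K' · N_E^{11/2+ε}`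
  (if the recorded `|Δ_min|` were the junk value `0` the product is `0`);
* `ω(N_E) = 0`: `N_E = 1` (`0` is not squarefree), the empty product is `1 < 6`.
This is the complete published argument for Theorem 1.12 modulo its two inputs, which are the
named facts `pastenShimura2024_cor_16_2` (Shimura-curve bounds, §16.1) and
`mestreOesterle1989_thm_1` (prime conductor); the discharge `pastenShimura2024_thm_1_12_holds`
is exactly this theorem applied to their discharges.
[cite: PastenShimura2024, Theorem 16.5 (arXiv numbering), proof of the first part] -/
theorem pastenShimura2024_thm_1_12_of_cor_16_2 (h16 : pastenShimura2024_cor_16_2)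
    (hMO : mestreOesterle1989_thm_1) : pastenShimura2024_thm_1_12 := by
  intro ε hε
  obtain ⟨K, hK, hKW⟩ := h16 ∅ ε hε
  refine ⟨max K 6, lt_max_of_lt_right (by norm_num), ?_⟩
  intro W _ hsq
  have hN0 : W.conductorNorm ℤ ≠ 0 := fun h => not_squarefree_zero (h ▸ hsq)
  have hNpow : (1 : ℝ) ≤ (W.conductorNorm ℤ : ℝ) ^ (11 / 2 + ε : ℝ) :=
    Real.one_le_rpow (by exact_mod_cast Nat.one_le_iff_ne_zero.mpr hN0) (by linarith)
  have h6 : (6 : ℝ) ≤ max K 6 * (W.conductorNorm ℤ : ℝ) ^ (11 / 2 + ε : ℝ) := by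
    calc (6 : ℝ) = 6 * 1 := (mul_one _).symm
      _ ≤ max K 6 * (W.conductorNorm ℤ : ℝ) ^ (11 / 2 + ε : ℝ) :=
        mul_le_mul (le_max_right _ _) hNpow zero_le_one (le_trans (by norm_num) (le_max_right _ _))
  -- no prime has `p² ∣ N_E` for a squarefree conductor
  have hnsq : ∀ p : ℕ, p.Prime → ¬ p ^ 2 ∣ W.conductorNorm ℤ := by
    intro p hp h2
    rw [Nat.squarefree_iff_prime_squarefree] at hsq
    exact hsq p hp (by simpa [sq] using h2)
  rcases Nat.lt_or_ge (W.conductorNorm ℤ).primeFactors.card 2 with hlt | hge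
  · -- at most one bad prime: `N_E = 1` or `N_E = p` prime (Mestre–Oesterlé)
    rcases Nat.lt_succ_iff_lt_or_eq.mp hlt with h0 | h1
    · -- `ω(N_E) = 0`
      have hempty : (W.conductorNorm ℤ).primeFactors = ∅ :=
        Finset.card_eq_zero.mp (Nat.lt_one_iff.mp h0)
      rw [hempty, Finset.prod_empty, Nat.cast_one]
      linarith
    · -- `ω(N_E) = 1`
      obtain ⟨p, hp⟩ := Finset.card_eq_one.mp h1
      have hpmem : p ∈ (W.conductorNorm ℤ).primeFactors := by
        rw [hp]; exact Finset.mem_singleton_self p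
      have hpprime : p.Prime := Nat.prime_of_mem_primeFactors hpmem
      have hNp : W.conductorNorm ℤ = p := by
        rw [← Nat.prod_primeFactors_of_squarefree hsq, hp, Finset.prod_singleton]
      rw [hp, Finset.prod_singleton]
      by_cases hΔ : W.minimalDiscriminantNorm ℤ = 0
      · rw [hΔ, Nat.factorization_zero, Finsupp.zero_apply, Nat.cast_zero]
        linarith
      · have h5 := mestreOesterle1989_thm_1.factorization_le hMO W (hNp ▸ hpprime) hΔ
        rw [hNp] at h5
        have h5' : (((W.minimalDiscriminantNorm ℤ).factorization p : ℕ) : ℝ) ≤ 5 := by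
          exact_mod_cast h5
        linarith
  · -- at least two bad primes: Corollary 16.2 with `S = ∅`
    have hfilter : ((W.conductorNorm ℤ).primeFactors.filter
        (fun p => ¬ p ^ 2 ∣ W.conductorNorm ℤ)) = (W.conductorNorm ℤ).primeFactors :=
      Finset.filter_true_of_mem fun p hp => hnsq p (Nat.prime_of_mem_primeFactors hp)
    have h2 : 2 ≤ ((W.conductorNorm ℤ).primeFactors.filter
        (fun p => ¬ p ^ 2 ∣ W.conductorNorm ℤ)).card := by
      rw [hfilter]; exact hge
    have hlt := hKW W (fun p hp _ => hnsq p hp) h2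
    rw [multiplicativeValuationProduct_eq_of_squarefree W hsq] at hlt
    calc _ < K * (W.conductorNorm ℤ : ℝ) ^ (11 / 2 + ε : ℝ) := hlt
      _ ≤ max K 6 * (W.conductorNorm ℤ : ℝ) ^ (11 / 2 + ε : ℝ) :=
        mul_le_mul_of_nonneg_right (le_max_left _ _) (le_trans zero_le_one hNpow)


/-! ### Corollary 16.2 from Theorem 16.1 (Pasten, arXiv:1705.09251 p. 49) -/

section Cor162

open Finset

/-- `(a b c d)² ≤ (b c d)(a c d)(a b d)` in `ℕ` (i.e. `d² ≤ d³`): the inequality behind "each of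
the `n` primes lies in `n - 1` of the factorisations `N_E^*/p_i`" for three primes. [folklore] -/
private theorem sq_mul_four_le (a b c d : ℕ) :
    (a * b * c * d) ^ 2 ≤ (b * c * d) * (a * c * d) * (a * b * d) := by
  have hd : d ^ 2 ≤ d ^ 3 := by
    rcases Nat.eq_zero_or_pos d with rfl | hd
    · simp
    · exact Nat.pow_le_pow_right hd (by norm_num)
  calc (a * b * c * d) ^ 2 = (a * b * c) ^ 2 * d ^ 2 := by ring
    _ ≤ (a * b * c) ^ 2 * d ^ 3 := Nat.mul_le_mul_left _ hd
    _ = (b * c * d) * (a * c * d) * (a * b * d) := by ring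

/-- **Pasten, Corollary 16.2 from Theorem 16.1, explicit constants** (arXiv:1705.09251, §16.1,
p. 49). Theorem 16.1 is the hypothesis `h16`, for ONE `ε` and ONE constant `K`, in the shape: for
`E/ℚ` semi-stable away from `S` and every admissible factorisation `N_E = D · M` — `D` the product
of a nonempty set of an even number of primes, `gcd(D, M) = 1` (so the primes of `D` are primes of
multiplicative reduction, `p ∥ N_E`) — `∏_{p ∣ D} v_p(Δ_E) < K · N_E^{11/3 + 2ε/3}`. Conclusion: if
`E` has at least two primes of multiplicative reduction then
`∏_{p ∣ N_E^*} v_p(Δ_E) < (max 1 K)² · N_E^{11/2+ε}`. Printed proof: "When `E` has an even number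
of primes of multiplicative reduction the result follows from Theorem 16.1 with `D = N_E^*`. When
`E` has an odd number `n` of primes of multiplicative reduction, necessarily `n ≥ 3` … Call these
primes `p_1, …, p_n`, then `∏_{p ∣ N_E^*} v_p(Δ_E) = (∏_{i=1}^n ∏_{p ∣ (N_E^*/p_i)} v_p(Δ_E))^{1/(n-1)}`.
The result follows from Theorem 16.1 for the various `D = N_E^*/p_i`, since
`11/3 · n/(n-1) ≤ 11/2`." Formalised with three of the `p_i` (each prime of `N_E^*` divides at
least two of the three `N_E^*/p_i`, so `(∏_{p ∣ N_E^*} v_p)² ≤ ∏_{i ≤ 3} ∏_{p ∣ N_E^*/p_i} v_p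
< (K N_E^{11/3+2ε/3})³`, and `11/3 · 3/2 = 11/2`; `K > 0` is forced by the hypothesis).
[cite: PastenShimura2024, Corollary 16.2 and its proof (arXiv numbering)] -/
theorem pastenShimura2024_cor_16_2_of_thm_16_1_explicit (S : Finset ℕ) {ε K : ℝ} (hε : 0 < ε)
    (h16 : ∀ (W : WeierstrassCurve ℚ) [W.IsElliptic],
      (∀ p : ℕ, p.Prime → p ∉ S → ¬ p ^ 2 ∣ W.conductorNorm ℤ) →
        ∀ (D : Finset ℕ) (M : ℕ), D.Nonempty → (∀ p ∈ D, p.Prime) → Even D.card →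
          (∏ p ∈ D, p) * M = W.conductorNorm ℤ → Nat.Coprime (∏ p ∈ D, p) M →
            ((∏ p ∈ D, (W.minimalDiscriminantNorm ℤ).factorization p : ℕ) : ℝ) <
              K * (W.conductorNorm ℤ : ℝ) ^ (11 / 3 + 2 * ε / 3 : ℝ))
    (W : WeierstrassCurve ℚ) [W.IsElliptic]
    (hS : ∀ p : ℕ, p.Prime → p ∉ S → ¬ p ^ 2 ∣ W.conductorNorm ℤ)
    (h2 : 2 ≤ ((W.conductorNorm ℤ).primeFactors.filter
      (fun p => ¬ p ^ 2 ∣ W.conductorNorm ℤ)).card) :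
    (multiplicativeValuationProduct W : ℝ) <
      (max 1 K) ^ 2 * (W.conductorNorm ℤ : ℝ) ^ (11 / 2 + ε : ℝ) := by
  classical
  set N := W.conductorNorm ℤ with hN
  set v : ℕ → ℕ := fun p => (W.minimalDiscriminantNorm ℤ).factorization p with hv
  set P := N.primeFactors.filter (fun p => ¬ p ^ 2 ∣ N) with hP
  set e : ℝ := 11 / 3 + 2 * ε / 3 with he
  have hmvp : multiplicativeValuationProduct W = ∏ p ∈ P, v p := rfl
  have hPsub : ∀ p ∈ P, p.Prime ∧ p ∣ N ∧ ¬ p ^ 2 ∣ N := by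
    intro p hp
    obtain ⟨hp1, hp2⟩ := Finset.mem_filter.1 hp
    exact ⟨Nat.prime_of_mem_primeFactors hp1, Nat.dvd_of_mem_primeFactors hp1, hp2⟩
  have hPne : P.Nonempty := Finset.card_pos.1 (by omega)
  have hN0 : N ≠ 0 := by
    obtain ⟨p, hp⟩ := hPne
    exact (Nat.mem_primeFactors.1 (Finset.mem_filter.1 hp).1).2.2
  have hN0' : (0 : ℝ) ≤ (N : ℝ) := Nat.cast_nonneg N
  have hN1 : (1 : ℝ) ≤ (N : ℝ) := by exact_mod_cast Nat.one_le_iff_ne_zero.2 hN0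
  have heε : e ≤ 11 / 2 + ε := by rw [he]; linarith
  have hK1 : (1 : ℝ) ≤ max 1 K := le_max_left _ _
  have hKle : K ≤ (max 1 K) ^ 2 := (le_max_right 1 K).trans (le_self_pow₀ hK1 two_ne_zero)
  -- Theorem 16.1 for the admissible factorisations `D ⊆ P`, `#D` even
  have hadm : ∀ D : Finset ℕ, D ⊆ P → D.Nonempty → Even D.card →
      ((∏ p ∈ D, v p : ℕ) : ℝ) < K * (N : ℝ) ^ e := by
    intro D hDP hDne hDeven
    have hDprime : ∀ p ∈ D, p.Prime := fun p hp => (hPsub p (hDP hp)).1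
    obtain ⟨M, hM⟩ : (∏ p ∈ D, p) ∣ N :=
      Finset.prod_primes_dvd N (fun p hp => (hDprime p hp).prime) fun p hp => (hPsub p (hDP hp)).2.1
    have hcop : Nat.Coprime (∏ p ∈ D, p) M := by
      rw [Nat.coprime_prod_left_iff]
      intro p hp
      rw [Nat.Prime.coprime_iff_not_dvd (hDprime p hp)]
      intro hpM
      apply (hPsub p (hDP hp)).2.2
      rw [hM, sq]
      exact mul_dvd_mul (Finset.dvd_prod_of_mem _ hp) hpM
    exact h16 W hS D M hDne hDprime hDeven hM.symm hcop
  rw [hmvp]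
  rcases Nat.even_or_odd P.card with heven | hodd
  · -- even number of multiplicative primes: `D = N_E^*`
    calc ((∏ p ∈ P, v p : ℕ) : ℝ) < K * (N : ℝ) ^ e := hadm P Finset.Subset.rfl hPne heven
      _ ≤ (max 1 K) ^ 2 * (N : ℝ) ^ (11 / 2 + ε : ℝ) :=
        mul_le_mul hKle (Real.rpow_le_rpow_of_exponent_le hN1 heε) (Real.rpow_nonneg hN0' e)
          (pow_nonneg (zero_le_one.trans hK1) 2)
  · -- odd number `n ≥ 3` of multiplicative primes: three factorisations `D = N_E^* / p_i`
    have h3 : 2 < P.card := by obtain ⟨k, hk⟩ := hodd; omega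
    obtain ⟨p₁, p₂, p₃, hp₁, hp₂, hp₃, h12, h13, h23⟩ := Finset.two_lt_card_iff.1 h3
    have hDi : ∀ q ∈ P, ((∏ p ∈ P.erase q, v p : ℕ) : ℝ) < K * (N : ℝ) ^ e := by
      intro q hq
      refine hadm (P.erase q) (Finset.erase_subset q P) ?_ ?_
      · exact Finset.card_pos.1 (by rw [Finset.card_erase_of_mem hq]; omega)
      · rw [Finset.card_erase_of_mem hq]; exact Nat.Odd.sub_odd hodd odd_one
    have hB₁ := hDi p₁ hp₁
    have hB₂ := hDi p₂ hp₂
    have hB₃ := hDi p₃ hp₃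
    -- each prime of `P` lies in two of the three sets `P \ {p_i}`
    have hm2 : p₂ ∈ P.erase p₁ := Finset.mem_erase.2 ⟨h12.symm, hp₂⟩
    have hm3 : p₃ ∈ (P.erase p₁).erase p₂ :=
      Finset.mem_erase.2 ⟨h23.symm, Finset.mem_erase.2 ⟨h13.symm, hp₃⟩⟩
    have hA : ∏ p ∈ P, v p =
        v p₁ * (v p₂ * (v p₃ * ∏ p ∈ ((P.erase p₁).erase p₂).erase p₃, v p)) := by
      rw [Finset.mul_prod_erase _ v hm3, Finset.mul_prod_erase _ v hm2, Finset.mul_prod_erase P v hp₁]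
    have hE₁ : ∏ p ∈ P.erase p₁, v p =
        v p₂ * (v p₃ * ∏ p ∈ ((P.erase p₁).erase p₂).erase p₃, v p) := by
      rw [Finset.mul_prod_erase _ v hm3, Finset.mul_prod_erase _ v hm2]
    have hE₂ : ∏ p ∈ P.erase p₂, v p =
        v p₁ * (v p₃ * ∏ p ∈ ((P.erase p₁).erase p₂).erase p₃, v p) := by
      have hm1 : p₁ ∈ P.erase p₂ := Finset.mem_erase.2 ⟨h12, hp₁⟩
      have hm3' : p₃ ∈ (P.erase p₂).erase p₁ :=
        Finset.mem_erase.2 ⟨h13.symm, Finset.mem_erase.2 ⟨h23.symm, hp₃⟩⟩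
      rw [Finset.erase_right_comm (s := P) (a := p₁) (b := p₂),
        Finset.mul_prod_erase _ v hm3', Finset.mul_prod_erase _ v hm1]
    have hE₃ : ∏ p ∈ P.erase p₃, v p =
        v p₁ * (v p₂ * ∏ p ∈ ((P.erase p₁).erase p₂).erase p₃, v p) := by
      have hm1 : p₁ ∈ P.erase p₃ := Finset.mem_erase.2 ⟨h13, hp₁⟩
      have hm2' : p₂ ∈ (P.erase p₃).erase p₁ :=
        Finset.mem_erase.2 ⟨h12.symm, Finset.mem_erase.2 ⟨h23, hp₂⟩⟩
      rw [Finset.erase_right_comm (s := P.erase p₁) (a := p₂) (b := p₃),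
        Finset.erase_right_comm (s := P) (a := p₁) (b := p₃),
        Finset.mul_prod_erase _ v hm2', Finset.mul_prod_erase _ v hm1]
    set C := ∏ p ∈ ((P.erase p₁).erase p₂).erase p₃, v p with hC
    have key : (∏ p ∈ P, v p) ^ 2 ≤
        (∏ p ∈ P.erase p₁, v p) * (∏ p ∈ P.erase p₂, v p) * (∏ p ∈ P.erase p₃, v p) :=
      calc (∏ p ∈ P, v p) ^ 2 = (v p₁ * v p₂ * v p₃ * C) ^ 2 := by rw [hA]; ring
        _ ≤ (v p₂ * v p₃ * C) * (v p₁ * v p₃ * C) * (v p₁ * v p₂ * C) := sq_mul_four_le _ _ _ _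
        _ = (∏ p ∈ P.erase p₁, v p) * (∏ p ∈ P.erase p₂, v p) * (∏ p ∈ P.erase p₃, v p) := by
          rw [hE₁, hE₂, hE₃]; ring
    -- pass to `ℝ`: `(∏ v)² < L³ ≤ R²`, `L = K N^e`, `R = (max 1 K)² N^{11/2+ε}`
    have h1 : ((∏ p ∈ P, v p : ℕ) : ℝ) ^ 2 ≤
        ((∏ p ∈ P.erase p₁, v p : ℕ) : ℝ) * ((∏ p ∈ P.erase p₂, v p : ℕ) : ℝ) *
          ((∏ p ∈ P.erase p₃, v p : ℕ) : ℝ) := by exact_mod_cast key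
    set L : ℝ := K * (N : ℝ) ^ e with hL
    have hB0 : ∀ q, (0 : ℝ) ≤ ((∏ p ∈ P.erase q, v p : ℕ) : ℝ) := fun q => Nat.cast_nonneg _
    have hLpos : 0 < L := (hB0 p₁).trans_lt hB₁
    have hsq : ((∏ p ∈ P, v p : ℕ) : ℝ) ^ 2 < L ^ 3 := by
      calc ((∏ p ∈ P, v p : ℕ) : ℝ) ^ 2 ≤ _ := h1
        _ ≤ L * L * ((∏ p ∈ P.erase p₃, v p : ℕ) : ℝ) :=
          mul_le_mul_of_nonneg_right (mul_le_mul hB₁.le hB₂.le (hB0 p₂) hLpos.le) (hB0 p₃)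
        _ < L * L * L := mul_lt_mul_of_pos_left hB₃ (mul_pos hLpos hLpos)
        _ = L ^ 3 := by ring
    have hNe : 0 < (N : ℝ) ^ e := Real.rpow_pos_of_pos (by exact_mod_cast Nat.pos_of_ne_zero hN0) e
    have hK0 : 0 < K := (mul_pos_iff_of_pos_right hNe).1 hLpos
    set R : ℝ := (max 1 K) ^ 2 * (N : ℝ) ^ (11 / 2 + ε : ℝ) with hR
    have hR0 : 0 ≤ R := mul_nonneg (pow_nonneg (zero_le_one.trans hK1) 2) (Real.rpow_nonneg hN0' _)
    have hN3 : ((N : ℝ) ^ e) ^ 3 = (N : ℝ) ^ (11 + 2 * ε : ℝ) := by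
      rw [← Real.rpow_natCast ((N : ℝ) ^ e) 3, ← Real.rpow_mul hN0']
      congr 1
      rw [he]; push_cast; ring
    have hN2 : ((N : ℝ) ^ (11 / 2 + ε : ℝ)) ^ 2 = (N : ℝ) ^ (11 + 2 * ε : ℝ) := by
      rw [← Real.rpow_natCast ((N : ℝ) ^ (11 / 2 + ε : ℝ)) 2, ← Real.rpow_mul hN0']
      congr 1
      push_cast; ring
    have hK34 : K ^ 3 ≤ (max 1 K) ^ 4 :=
      (pow_le_pow_left₀ hK0.le (le_max_right 1 K) 3).trans (pow_le_pow_right₀ hK1 (by norm_num))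
    have hLR : L ^ 3 ≤ R ^ 2 :=
      calc L ^ 3 = K ^ 3 * ((N : ℝ) ^ e) ^ 3 := by rw [hL]; ring
        _ = K ^ 3 * (N : ℝ) ^ (11 + 2 * ε : ℝ) := by rw [hN3]
        _ ≤ (max 1 K) ^ 4 * (N : ℝ) ^ (11 + 2 * ε : ℝ) :=
          mul_le_mul_of_nonneg_right hK34 (Real.rpow_nonneg hN0' _)
        _ = R ^ 2 := by rw [hR, mul_pow, ← hN2]; ring
    exact lt_of_pow_lt_pow_left₀ 2 hR0 (hsq.trans_le hLR)

/-- **Pasten, Corollary 16.2 from Theorem 16.1** (arXiv:1705.09251, §16.1, p. 49): the named fact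
`pastenShimura2024_cor_16_2` (constant form `K_{S,ε}`) follows from Theorem 16.1 taken as the
hypothesis `h16` — "for all but finitely many `E/ℚ` semi-stable away from `S` [here: up to a
constant `K_{S,ε}`] and every admissible factorisation `N = DM`, `∏_{p ∣ D} v_p(Δ_E) < N^{11/3+ε}`"
— by `pastenShimura2024_cor_16_2_of_thm_16_1_explicit` applied with `2ε/3` and the constant
`(max 1 K)²`. Theorem 16.1 itself (Shimura-curve parametrisations `X_0^D(M) → E`, the refined
Ribet–Takahashi formula, Arakelov-type lower bounds for integral quaternionic forms, the Manin
constant) is far beyond the present library and is NOT vendored as a separate fact (D-0026).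
[cite: PastenShimura2024, Corollary 16.2 (arXiv numbering), proof] -/
theorem pastenShimura2024_cor_16_2_of_thm_16_1
    (h16 : ∀ (S : Finset ℕ) (ε : ℝ), 0 < ε → ∃ K : ℝ, 0 < K ∧
      ∀ (W : WeierstrassCurve ℚ) [W.IsElliptic],
        (∀ p : ℕ, p.Prime → p ∉ S → ¬ p ^ 2 ∣ W.conductorNorm ℤ) →
          ∀ (D : Finset ℕ) (M : ℕ), D.Nonempty → (∀ p ∈ D, p.Prime) → Even D.card →
            (∏ p ∈ D, p) * M = W.conductorNorm ℤ → Nat.Coprime (∏ p ∈ D, p) M →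
              ((∏ p ∈ D, (W.minimalDiscriminantNorm ℤ).factorization p : ℕ) : ℝ) <
                K * (W.conductorNorm ℤ : ℝ) ^ (11 / 3 + ε : ℝ)) :
    pastenShimura2024_cor_16_2 := by
  intro S ε hε
  obtain ⟨K, -, hK⟩ := h16 S (2 * ε / 3) (by positivity)
  exact ⟨(max 1 K) ^ 2, by positivity, fun W _ hS h2 =>
    pastenShimura2024_cor_16_2_of_thm_16_1_explicit S hε hK W hS h2⟩

/-- **Pasten, Corollary 16.2 in its printed "all but finitely many `E`" shape** from the constant
form `pastenShimura2024_cor_16_2`: given `S` and `ε > 0` there is `N₀` such that every `E/ℚ`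
semi-stable away from `S`, with at least two primes of multiplicative reduction and `N_E ≥ N₀`, has
`∏_{p ∣ N_E^*} v_p(Δ_E) < N_E^{11/2+ε}` (use the constant form with `ε/2` and `N₀ = ⌈K^{2/ε}⌉`, so
that `K ≤ N_E^{ε/2}`). [cite: PastenShimura2024, Corollary 16.2 (arXiv numbering)] -/
theorem pastenShimura2024_cor_16_2.eventually (h : pastenShimura2024_cor_16_2) (S : Finset ℕ)
    {ε : ℝ} (hε : 0 < ε) :
    ∃ N₀ : ℕ, ∀ (W : WeierstrassCurve ℚ) [W.IsElliptic], N₀ ≤ W.conductorNorm ℤ →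
      (∀ p : ℕ, p.Prime → p ∉ S → ¬ p ^ 2 ∣ W.conductorNorm ℤ) →
        2 ≤ ((W.conductorNorm ℤ).primeFactors.filter
          (fun p => ¬ p ^ 2 ∣ W.conductorNorm ℤ)).card →
          (multiplicativeValuationProduct W : ℝ) < (W.conductorNorm ℤ : ℝ) ^ (11 / 2 + ε : ℝ) := by
  obtain ⟨K, hK, hKW⟩ := h S (ε / 2) (half_pos hε)
  refine ⟨⌈K ^ (2 / ε)⌉₊, fun W _ hN hS h2 => ?_⟩
  have hN0 : W.conductorNorm ℤ ≠ 0 := by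
    obtain ⟨p, hp⟩ := Finset.card_pos.1 (lt_of_lt_of_le zero_lt_two h2)
    exact (Nat.mem_primeFactors.1 (Finset.mem_filter.1 hp).1).2.2
  have hNpos : (0 : ℝ) < (W.conductorNorm ℤ : ℝ) := by exact_mod_cast Nat.pos_of_ne_zero hN0
  have hKle : K ≤ (W.conductorNorm ℤ : ℝ) ^ (ε / 2) := by
    have h1 : K ^ (2 / ε) ≤ (W.conductorNorm ℤ : ℝ) := (Nat.le_ceil _).trans (by exact_mod_cast hN)
    have h2' : (2 / ε) * (ε / 2) = 1 := by
      rw [div_mul_div_comm, mul_comm 2 ε, div_self (by positivity)]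
    calc K = (K ^ (2 / ε)) ^ (ε / 2) := by rw [← Real.rpow_mul hK.le, h2', Real.rpow_one]
      _ ≤ (W.conductorNorm ℤ : ℝ) ^ (ε / 2) :=
        Real.rpow_le_rpow (Real.rpow_nonneg hK.le _) h1 (by positivity)
  calc (multiplicativeValuationProduct W : ℝ)
      < K * (W.conductorNorm ℤ : ℝ) ^ (11 / 2 + ε / 2 : ℝ) := hKW W hS h2
    _ ≤ (W.conductorNorm ℤ : ℝ) ^ (ε / 2) * (W.conductorNorm ℤ : ℝ) ^ (11 / 2 + ε / 2 : ℝ) :=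
        mul_le_mul_of_nonneg_right hKle (Real.rpow_nonneg hNpos.le _)
    _ = (W.conductorNorm ℤ : ℝ) ^ (11 / 2 + ε : ℝ) := by
        rw [← Real.rpow_add hNpos]; congr 1; ring

/-- The fact `pastenShimura2024_cor_16_2` of `ValuationProductElliptic` and the fact
`pasten_valuationProduct_awayFrom` of `PastenValuationProducts` (same topic, vendored twice from
Pasten's Corollary 16.2) are literally the same statement (`multiplicativeValuationProduct` unfolds
to the filtered product). [cite: PastenShimura2024, Corollary 16.2 (arXiv numbering)] -/
theorem pastenShimura2024_cor_16_2_iff_pasten_valuationProduct_awayFrom :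
    pastenShimura2024_cor_16_2 ↔ pasten_valuationProduct_awayFrom :=
  Iff.rfl

end Cor162

end Literature.NumberTheory.DiophantineGeometry

end
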